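import Literature.Computability.Complexity.PNPNaturalProofs
import Literature.Computability.Cryptography.ClassBQP
import HarnessLib

/-!
# The natural-proofs barrier for `BQP ⊄ P/poly` (Razborov–Rudich)

Trunk T-CPLX-CORE (Literature/Computability/Complexity); cite item `wi-03599` (route
QuantumAdvantage/CircuitLB). Companion to `PNPNaturalProofs.lean`, whose vocabulary
(`CombinatorialProperty`, `IsNatural`, `IsUsefulAgainstPPoly`, `IsUsefulAgainst`, `PRGFamily`,
`prgHardness`, and the named fact `natural_proofs_barrier` = Razborov–Rudich 1997, Thm. 4.1) is
reused verbatim.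

A *natural proof of `BQP ⊄ P/poly`* is a `P/poly`-natural combinatorial property `P`
(constructive in polynomial size, large — RR §2) which is useful against `P/poly` and which is
enjoyed, for infinitely many input lengths, by the slices of some language in `BQP` (so that
usefulness in the language form certifies `L ∉ P/poly`, `bqp_not_subset_PPoly_of_isNaturalProof`).
Razborov–Rudich's main theorem then says: such a proof forces every pseudo-random generator
family computable in `P/poly` to have hardness `< 2^{k^ε}` infinitely often, for every `ε > 0`
(`hardness_lt_of_isNaturalProofBQP`); contrapositively, if `2^{k^ε}`-hard generators in `P/poly`
exist (as follows from exponentially hard PRFs/OWFs, e.g. factoring- or lattice-based against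
non-uniform adversaries), then there is no natural proof of `BQP ⊄ P/poly`
(`not_isNaturalProofBQP_of_hard_prg`). Both are derived here from the tree's fact
`natural_proofs_barrier`; nothing new is assumed.

## Sources

* A. A. Razborov, S. Rudich, *Natural proofs*, J. Comput. Syst. Sci. 55 (1997), §2 (natural,
  useful), Thm. 4.1 (main theorem: natural proofs vs pseudo-random generators).
* S. Arora, B. Barak, *Computational Complexity* (2009), Def. 23.1, Thm. 23.4.
-/

noncomputable section

namespace Literature.Computability.Complexity

open _root_.Computability MetaComplexity Cryptography Filter

/-- **A natural proof of `BQP ⊄ P/poly`**: a `P/poly`-natural combinatorial property `P`, useful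
against `P/poly` (per-length size form `IsUsefulAgainstPPoly`, the hypothesis of RR Thm. 4.1),
containing the slices `L ∩ {0,1}ⁿ` of some `BQP` language for infinitely many `n`.
[Razborov–Rudich 1997, §2 (natural proofs against `P/poly` of a lower bound for an explicit
function); Arora–Barak 2009, Def. 23.1] [cite: RazborovRudich1997, §2] -/
def IsNaturalProofBQPNotPPoly (P : CombinatorialProperty) : Prop :=
  IsNatural PPoly P ∧ IsUsefulAgainstPPoly P ∧ ∃ L ∈ BQP, ∃ᶠ n in atTop, L.sliceFn n ∈ P n

/-- What such a proof proves: if `P` is moreover useful against `P/poly` in the language form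
(`IsUsefulAgainst PPoly P`: every language with slices in `P` infinitely often lies outside
`P/poly` — implied by the size form, RR §2), then `BQP ⊄ P/poly`. [Razborov–Rudich 1997, §2;
Arora–Barak 2009, Def. 23.1] [folklore] -/
theorem bqp_not_subset_PPoly_of_isNaturalProof {P : CombinatorialProperty}
    (h : IsNaturalProofBQPNotPPoly P) (hU : IsUsefulAgainst PPoly P) : ¬ BQP ⊆ PPoly := by
  obtain ⟨-, -, L, hL, hfreq⟩ := h
  exact fun hsub => hU L hfreq (hsub hL)

/-- **Natural-proofs barrier for `BQP ⊄ P/poly`** (from Razborov–Rudich Thm. 4.1, the tree's fact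
`natural_proofs_barrier`): a natural proof of `BQP ⊄ P/poly` forces every generator family
`G = (Gₖ : {0,1}ᵏ → {0,1}²ᵏ)` computable in `P/poly` to have hardness `H(Gₖ) < 2^{k^ε}` for
infinitely many `k`, for every `ε > 0` — i.e. no `P/poly` PRG (hence no `P/poly` PRF/OWF-based
generator) is `2^{k^ε}`-hard against circuits. [Razborov–Rudich 1997, Thm. 4.1] [folklore] -/
theorem hardness_lt_of_isNaturalProofBQP (hRR : natural_proofs_barrier) {P : CombinatorialProperty}
    (h : IsNaturalProofBQPNotPPoly P) (G : PRGFamily) (hG : G.IsInPPoly) {ε : ℝ} (hε : 0 < ε) :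
    ∃ᶠ k : ℕ in atTop, prgHardness (G k) < (⌈(2 : ℝ) ^ ((k : ℝ) ^ ε)⌉₊ : ℕ∞) :=
  hRR P h.1 h.2.1 G hG ε hε

/-- Contrapositive: if some generator family in `P/poly` is `2^{k^ε}`-hard for all large `k`
(some `ε > 0`), then there is NO natural proof of `BQP ⊄ P/poly`. [Razborov–Rudich 1997,
Thm. 4.1 (as usually quoted)] [folklore] -/
theorem not_isNaturalProofBQP_of_hard_prg (hRR : natural_proofs_barrier)
    (hG : ∃ G : PRGFamily, G.IsInPPoly ∧ ∃ ε : ℝ, 0 < ε ∧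
      ∀ᶠ k : ℕ in atTop, (⌈(2 : ℝ) ^ ((k : ℝ) ^ ε)⌉₊ : ℕ∞) ≤ prgHardness (G k)) :
    ¬ ∃ P : CombinatorialProperty, IsNaturalProofBQPNotPPoly P := by
  rintro ⟨P, hP⟩
  obtain ⟨G, hGP, ε, hε, hk⟩ := hG
  exact (hardness_lt_of_isNaturalProofBQP hRR hP G hGP hε) (hk.mono fun k hk' => not_lt.mpr hk')

/-- A natural proof of `BQP ⊄ P/poly` is in particular a `P/poly`-natural property useful against
`P/poly` (the object RR's theorem is about). [Razborov–Rudich 1997, §2] [folklore] -/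
theorem IsNaturalProofBQPNotPPoly.isNatural_and_useful {P : CombinatorialProperty}
    (h : IsNaturalProofBQPNotPPoly P) : IsNatural PPoly P ∧ IsUsefulAgainstPPoly P :=
  ⟨h.1, h.2.1⟩

end Literature.Computability.Complexity
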